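import Literature.NumberTheory.EllipticCurves.ZpExtensionEisensteinDVRSettingH4BadPlacesProofs
import Literature.NumberTheory.EllipticCurves.ZpExtensionEisensteinTwistLocalH1UniformBoundProofs
import Literature.NumberTheory.Automorphic.GaloisActionPlaces
import HarnessLib

/-!
# Howard's H.4 for F_𝔮 at the bad places `v ∈ S ∖ {v ∣ p}`, UNIFORMLY for `m ≫ 0` — the `v ∤ p` clause of `Stmt.h4AtS`
# (theorems only)

`Proofs` file (theorems only; no definition, no named fact, no instance, no `sorry`).  Topic `NumberTheory/EllipticCurves`
(D1 road of cell `pub/bsd-print-x9`, LEAD `bsd-line-x10b-p1` g8; sequel of `ZpExtensionEisensteinDVRSettingH4BadPlacesProofs` (p667328)).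

The (N1) input of `eisensteinTower_isSelfOrthogonalAt_of_mem_of_not_mem_ofLifts` — «`p^c` kills `H¹(K_w, E_K[p^j] ⊗ A_{m,j}(ψ))`
for every `j`» at `w = v` and `w = σ•v` — is x9-p1-w4 g5's `exists_forall_pow_smul_galoisCohomology_one_toLocal_eq_zero_uniform`
(p657002): it holds for every `m > 2N_w` as soon as `w ∤ p` is finitely decomposed in `K_∞/K` (`hdec`).  Taking the maximum of the
`2N_w` over the finitely many `w ∈ S`:

* **`WeierstrassCurve.eisensteinTower_exists_forall_isSelfOrthogonalAt_of_not_mem`** — for `σ`-stable `S` whose places prime to `p`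
  are finitely decomposed in `K_∞` (on the μ-letter's frames: x10b-p1-w5 g2's (HDEC-N) / x9-p2's `not_decomp_le_kerSubgroup_of_natCast_mem`,
  from (Heeg)), THERE IS `m₄` such that for every `m > m₄`, every prime set `𝓛`, every involutive lift `τ` of `σ`, every H.4 datum
  `D` on the Eisenstein tower with `he_red`, given the Poitou–Tate named fact: **`(D k).IsSelfOrthogonalAt F_𝔮 v` for all `k` and
  all `v ∈ S` with `v ∤ p`** — the `v ∤ p` half of the input `Stmt.h4AtS` of D1's STUB-A assembly, in its `∃ m₄ ∀ m` shape.
What remains of `Stmt.h4AtS` is the `v ∣ p` half ((Exact) at `v ∣ p`, memo HOME/p1/H4-EXACT-AT-P-PLAN).  HONEST FRAMING: conditional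
on `poitouTate_selmerStructure_duality K`.  No summit statement is proved; BSD is not proved by any of this.

References: B. Howard, Compositio Math. 140 (2004), §1.3 H.4, Lemma 2.2.7, Def. 3.1.2 (arXiv:1202.6340 p. 7, p. 14–16);
J. S. Milne, *Arithmetic Duality Theorems* (2006), I Cor. 2.3, Thm. 2.6, Thm. 2.8; D. Brink, Thm. 2 (2007).
-/

set_option autoImplicit false

noncomputable section

open Function NumberField IsDedekindDomain Field CategoryTheory
open scoped NumberField ContRepresentation TensorProduct Classical

namespace WeierstrassCurve

open Literature.NumberTheory.EllipticCurves Literature.NumberTheory.GaloisRepresentations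
open Literature.NumberTheory.GaloisRepresentations.DiscreteGaloisModule
open Literature.NumberTheory.GaloisCohomology Literature.NumberTheory.GaloisCohomology.Howard2004
open Literature.NumberTheory.EllipticCurves.ZpExtension (EisensteinLevel)
open Literature.NumberTheory.Automorphic

variable {K : Type} [Field K] [NumberField K] (W : WeierstrassCurve ℚ) [W.IsElliptic] {p : ℕ} [hp : Fact p.Prime]
  (κ : ZpExtension K p)
  (S : Finset (HeightOneSpectrum (𝓞 K)))
  (hpS : ∀ v : HeightOneSpectrum (𝓞 K), ((p : ℕ) : 𝓞 K) ∈ v.asIdeal → v ∈ S)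
  (hbad : ∀ v : HeightOneSpectrum (𝓞 K), v ∉ S → ((p : ℕ) : 𝓞 K) ∉ v.asIdeal → (W.baseChange K).HasGoodReductionAt v)

omit [W.IsElliptic] hp in
/-- `σ` fixes the rational prime `p`, so `p ∈ σ•v ↔ p ∈ v`. [cite: SilvermanAEC2009, VIII.1] -/
theorem natCast_mem_smul_asIdeal_iff (σ : K ≃ₐ[ℚ] K) (v : HeightOneSpectrum (𝓞 K)) :
    ((p : ℕ) : 𝓞 K) ∈ (σ • v).asIdeal ↔ ((p : ℕ) : 𝓞 K) ∈ v.asIdeal := by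
  have hσp : σ • (((p : ℕ) : 𝓞 K)) = ((p : ℕ) : 𝓞 K) := map_natCast (MulSemiringAction.toRingHom _ (𝓞 K) σ) p
  conv_lhs => rw [← hσp]
  exact HeightOneSpectrum.smul_mem_smul_asIdeal_iff σ v _

/-- **The `v ∤ p` half of `Stmt.h4AtS`, uniformly in `m ≫ 0`.**  For `σ`-stable `S ⊇ {v ∣ p} ∪ {bad}` whose places prime to
`p` do not split completely in `K_∞` there is `m₄` such that for all `m > m₄`: for every admissible prime set `𝓛`, every
involutive lift `τ` of `σ`, every H.4 datum `D` on `W.eisensteinTower κ hm` satisfying `he_red`, and given the Poitou–Tate named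
fact, `F_𝔮` is its own exact orthogonal complement at every `v ∈ S` with `v ∤ p`, at every level `k`.
[cite: Howard2004HeegnerKolyvagin, §1.3 H.4, Lemma 2.2.7 and Def. 3.1.2 (arXiv p. 7 L78–82, p. 14–16)]
[cite: MilneADT2006, Ch. I, Cor. 2.3, Thm. 2.6, Thm. 2.8] [cite: Brink2007, Thm. 2] -/
theorem eisensteinTower_exists_forall_isSelfOrthogonalAt_of_not_mem (σ : K ≃ₐ[ℚ] K) (hσ₁ : σ ≠ 1) (hσ : σ * σ = 1)
    (hSσ : ∀ v : HeightOneSpectrum (𝓞 K), σ • v ∈ S → v ∈ S)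
    (hdec : ∀ v ∈ S, ((p : ℕ) : 𝓞 K) ∉ v.asIdeal → ¬ (GreenbergSelmer.decomp v ≤ κ.kerSubgroup)) :
    ∃ m₄ : ℕ, ∀ (m : ℕ) (hm : 1 ≤ m), m₄ < m →
      letI := IwasawaAlgebra.isLocalRing_quotient_X_pow_add_C p hm
      ∀ (L : Set (HeightOneSpectrum (𝓞 K))) (hL : L ⊆ (W.eisensteinTower κ hm).degreeTwoPrimes p) (hLS : ∀ v ∈ L, v ∉ S)
        (τ : AlgebraicClosure K ≃+* AlgebraicClosure K) (hτl : IsLiftOfAut σ τ) (hτ₂ : Function.Involutive τ)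
        (D' : ∀ k, DualityDatum p (ConjugationDatum.ofLifts σ hσ₁ hσ τ hτl hτ₂) ((W.eisensteinTower κ hm).ρ k)
          (IwasawaAlgebra.EisensteinCoeff p m (k + 1))),
        (∀ k (x y : EisensteinLevel p m (fun j ↦ geomTorsion (W.baseChange K) ((p : ℤ) ^ j)) (k + 1 + 1)),
          IwasawaAlgebra.EisensteinCoeff.reduce p m (Nat.le_succ (k + 1)) ((D' (k + 1)).e x y) =
            (D' k).e ((W.eisensteinTower κ hm).red k x) ((W.eisensteinTower κ hm).red k y)) →
        poitouTate_selmerStructure_duality K →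
        ∀ (k : ℕ) (v : HeightOneSpectrum (𝓞 K)), v ∈ S → ((p : ℕ) : 𝓞 K) ∉ v.asIdeal →
          (D' k).IsSelfOrthogonalAt (W.eisensteinTowerTriple κ hm S hpS hbad L hL hLS k).cond v := by
  classical
  -- the per-place (N1) bound `N_v` (and a dummy `0` where nothing is claimed)
  have hv : ∀ v ∈ S, ((p : ℕ) : 𝓞 K) ∉ v.asIdeal →
      ∃ Nv : ℕ, 1 ≤ Nv ∧ ∀ (m : ℕ) (hm : 1 ≤ m), 2 * Nv < m → ∀ (j : ℕ)
        (x : galoisCohomology (GaloisRep.toLocal v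
          (κ.eisensteinTwist ((W.baseChange K).torsionGaloisModule ((p : ℤ) ^ j)) hm j)) 1), p ^ (8 * Nv) • x = 0 :=
    fun v hvS hpv ↦ exists_forall_pow_smul_galoisCohomology_one_toLocal_eq_zero_uniform v (W.baseChange K) κ hpv (hdec v hvS hpv)
  choose! Nv hNv using hv
  refine ⟨S.sup (fun v ↦ 2 * Nv v), fun m hm hm₄ L hL hLS τ hτl hτ₂ D' he_red hPT k v hvS hpv ↦ ?_⟩
  -- `σ•v ∈ S`, `σ•v ∤ p`, and both `2N_v, 2N_{σv} < m`
  have hσvS : σ • v ∈ S := hSσ _ (by rwa [smul_smul, hσ, one_smul])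
  have hσpv : ((p : ℕ) : 𝓞 K) ∉ (σ • v).asIdeal := fun h ↦ hpv ((natCast_mem_smul_asIdeal_iff (K := K) (p := p) σ v).1 h)
  have h2v : 2 * Nv v < m := lt_of_le_of_lt (Finset.le_sup (f := fun v ↦ 2 * Nv v) hvS) hm₄
  have h2σv : 2 * Nv (σ • v) < m := lt_of_le_of_lt (Finset.le_sup (f := fun v ↦ 2 * Nv v) hσvS) hm₄
  exact W.eisensteinTower_isSelfOrthogonalAt_of_mem_of_not_mem_ofLifts κ hm S hpS hbad L hL hLS σ hσ₁ hσ τ hτl hτ₂ D'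
    he_red hPT k hpv hvS hσpv hσvS
    (fun j x ↦ (hNv v hvS hpv).2 m hm h2v (j + 1) x) (fun j x ↦ (hNv (σ • v) hσvS hσpv).2 m hm h2σv (j + 1) x)

end WeierstrassCurve

end
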